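import Summits.ResolutionOfSingularities.ResolutionOfSingularities.Theorems.HomologicalConductorNoZenoRFirstKindDisjoint
import Summits.ResolutionOfSingularities.ResolutionOfSingularities.Theorems.HomologicalConductorNoZenoRLipman165
import Summits.ResolutionOfSingularities.ResolutionOfSingularities.Theorems.HomologicalConductorNoZenoIncidenceGraphAcyclic
import Literature.AlgebraicGeometry.Resolution.ExcCurveBiadditivityDisjoint
import Literature.AlgebraicGeometry.Resolution.ExcDivisorDegreeH0
import HarnessLib

/-!
# Crux `NoZenoR` (stmt-ResolutionOfSingularities-19943) — a FIRST-KIND curve `E` inside an exceptional cycle `Z ∋ E`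
# with `h⁰(𝒪_Z) ≤ 1` and `(Z·E) < 0` IS the whole cycle: `Z = E` (numerical core of a Castelnuovo-free road to the
# W3 prints Lipman (27.3) / (27.1))

Route `ResolutionOfSingularities/HomologicalConductor` (cell decomp-res, hand leafhand-res-homologicalconduct-24 g0).
OURS: AI-written proof over tree theorems, weaker than expert review; nothing here is a statement of the manuscript
under review (Hironaka 2017).  SUPPORT level, counted 0.  Def-free, fact-free (Lipman (13.1) d) for effective
exceptional divisors, (13.1) c) «≥ 0», and `1 ≤ h⁰` are tree theorems).

Setting: `S` a two-dimensional Noetherian local normal domain with a RATIONAL singularity, `π : X → Spec S` a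
desingularization, `E = E_η` an integral exceptional curve OF THE FIRST KIND (`h⁰(𝓘_η²) = 3·h⁰(𝓘_η)`, i.e.
`(E·E) = −h⁰(E)`), and `Z = V(∏_{ζ ∈ t} 𝓘_ζ)` an effective exceptional divisor (a multiset `t` of integral exceptional
curves).  Writing `Z = E + F` (`t = η ::ₘ u`, `F = V(∏_{ζ∈u} 𝓘_ζ)`):

* `excCurveDegree_cons_eq_h0_sub_of_firstKind` — **`(Z·E) = h⁰(𝒪_F) − h⁰(𝒪_Z)`**: by (13.1) d) for the effective
  divisor `F` (`excCurveDegree_prod_eq_h0`: `(F·E) = h⁰(E) + h⁰(F) − h⁰(E+F)`) and `(E·E) = −h⁰(E)`;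
* `eq_zero_of_firstKind_of_h0_le_one_of_excCurveDegree_neg` — hence if `h⁰(𝒪_Z) ≤ 1` and `(Z·E) < 0` then `F = 0`
  (`1 ≤ h⁰(𝒪_F)` for `F ≠ 0`, `ExcCount.one_le_h0_prod`);
* `mem_of_excCurveDegree_prod_neg` — `(Z·E_η) < 0` forces `η ∈ t` ((13.1) c): an effective divisor avoiding `η` meets
  `E_η` non-negatively);
* **`eq_singleton_of_firstKind_of_h0_le_one_of_excCurveDegree_neg`** — MAIN: `h⁰(𝒪_Z) ≤ 1`, `(Z·E_η) < 0`, `E_η` of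
  the first kind ⇒ `t = {η}`, i.e. `Z = E_η`.

Use (road memo of this hand, HOME/leafhand-res-homologicalconduct-24-g0): with `Z` the cycle of the base ideal
`𝔪𝒪_X` (`h⁰(𝒪_X/𝔪𝒪_X) ≤ 1`, tree `QuadraticTransform.h0_baseIdeal_maximalIdeal_le_one`; `(Z·E) ≤ 0` always), a
first-kind curve NOT contracted by `X → Bl_𝔪 Spec S` (`(Z·E) < 0`) forces `𝔪𝒪_X = 𝓘_η`, whence `S` regular; so over a
NON-regular rational `S` every first-kind curve is contracted to a closed point of the quadratic transform — the
induction step of «the minimal desingularization has no first-kind curve» ((27.3) «⇒») without Castelnuovo's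
contraction theorem.  No crux or summit statement is proved here.
-/

noncomputable section

-- single-problem summit: the doubled namespace component `ResolutionOfSingularities` is forced
set_option linter.dupNamespace false

open CategoryTheory AlgebraicGeometry TopologicalSpace IsLocalRing
open Literature.AlgebraicGeometry.Resolution Literature.AlgebraicGeometry.Motives

universe u

namespace Summit.ResolutionOfSingularities.ResolutionOfSingularities.Theorems.NoZeno.FirstKind

variable {S : Type u} [CommRing S] [IsNoetherianRing S] [IsLocalRing S] [IsDomain S] [IsIntegrallyClosed S]
  {X : Scheme.{u}} [IsIntegral X] [IsLocallyNoetherian X] {π : X ⟶ Spec (.of S)}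

/-- **`(Z·E) = h⁰(𝒪_F) − h⁰(𝒪_Z)` for `Z = E + F`, `E` of the first kind** (`S` rational, `π` a desingularization,
`E = E_η`, `F = V(∏_{ζ∈u} 𝓘_ζ)`, `Z = V(𝓘_η · ∏_{ζ∈u} 𝓘_ζ)`): Lipman (13.1) d) for the effective exceptional divisor
`F`, `(F·E) = h⁰(E) + h⁰(F) − h⁰(E+F)`, plus `(E·E) = −h⁰(E)`.
[cite: Lipman1969, Proposition (13.1) b), d) (p. 223)] -/
theorem excCurveDegree_cons_eq_h0_sub_of_firstKind (h2 : ringKrullDim S = 2) (hS : HasRationalSingularity S)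
    (hπ : IsResolution π) {η : X} (hη : η ∈ excCurvePoints π)
    (hfk : h0 π (primeDivisorIdeal η ^ 2) = 3 * h0 π (primeDivisorIdeal η))
    (u : Multiset X) (hu : ∀ ζ ∈ u, ζ ∈ excCurvePoints π)
    (hZ : IsEffectiveCartier ((η ::ₘ u).map primeDivisorIdeal).prod) :
    excCurveDegree π (CartierDivisor.ofIsEffectiveCartier ((η ::ₘ u).map primeDivisorIdeal).prod hZ) η =
      ((h0 π (u.map primeDivisorIdeal).prod).toNat : ℤ) -
        ((h0 π ((η ::ₘ u).map primeDivisorIdeal).prod).toNat : ℤ) := by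
  classical
  haveI : IsProper π := hπ.isProper
  have hX : Scheme.IsRegular X := hπ.isRegular
  have hco : ∀ ζ ∈ excCurvePoints π, Order.coheight ζ = 1 := fun ζ hζ =>
    hπ.coheight_eq_one_of_mem_excCurvePoints h2 hζ
  have hE : IsEffectiveCartier (primeDivisorIdeal η) :=
    isEffectiveCartier_primeDivisorIdeal_of_isRegular hX (hco η hη)
  have hLu : IsEffectiveCartier (u.map primeDivisorIdeal).prod :=
    isEffectiveCartier_prod_primeDivisorIdeal hX u fun ζ hζ => hco ζ (hu ζ hζ)
  have e : ((η ::ₘ u).map primeDivisorIdeal).prod = primeDivisorIdeal η * (u.map primeDivisorIdeal).prod := by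
    rw [Multiset.map_cons, Multiset.prod_cons]
  revert hZ
  rw [e]
  intro hZ
  rw [excCurveDegree_congr_linEquiv π hη (sameDivisor_ofIsEffectiveCartier_mul _ _ hE hLu hZ).linEquiv,
    excCurveDegree_add π hη, excCurveDegree_self_eq_neg_h0_of_firstKind h2 hS hπ hη hE hfk,
    Lipman12B.excCurveDegree_prod_eq_h0_of_hasRationalSingularity h2 hS π hπ u hu hη hLu,
    mul_comm (u.map primeDivisorIdeal).prod (primeDivisorIdeal η)]
  ring

/-- **`Z = E + F`, `E` of the first kind, `h⁰(𝒪_Z) ≤ 1`, `(Z·E) < 0` ⇒ `F = 0`.**  From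
`(Z·E) = h⁰(𝒪_F) − h⁰(𝒪_Z)` and `1 ≤ h⁰(𝒪_F)` for a non-empty `F` (the generic point of a component of `F` is a point
of `V(𝓘_F)`, whose global sections therefore form a non-zero module of finite length).
[cite: Lipman1969, Proposition (13.1) b), d) (p. 223)] -/
theorem eq_zero_of_firstKind_of_h0_le_one_of_excCurveDegree_neg (h2 : ringKrullDim S = 2)
    (hS : HasRationalSingularity S) (hπ : IsResolution π) {η : X} (hη : η ∈ excCurvePoints π)
    (hfk : h0 π (primeDivisorIdeal η ^ 2) = 3 * h0 π (primeDivisorIdeal η))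
    (u : Multiset X) (hu : ∀ ζ ∈ u, ζ ∈ excCurvePoints π)
    (hZ : IsEffectiveCartier ((η ::ₘ u).map primeDivisorIdeal).prod)
    (hle : h0 π ((η ::ₘ u).map primeDivisorIdeal).prod ≤ 1)
    (hneg : excCurveDegree π (CartierDivisor.ofIsEffectiveCartier ((η ::ₘ u).map primeDivisorIdeal).prod hZ) η < 0) :
    u = 0 := by
  haveI : IsProper π := hπ.isProper
  by_contra hne
  have hid := excCurveDegree_cons_eq_h0_sub_of_firstKind h2 hS hπ hη hfk u hu hZ
  have h1 : (1 : ℤ) ≤ ((h0 π (u.map primeDivisorIdeal).prod).toNat : ℤ) := ExcCount.one_le_h0_prod π u hne hu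
  have hZ1 : ((h0 π ((η ::ₘ u).map primeDivisorIdeal).prod).toNat : ℤ) ≤ 1 := by
    have h := ENat.toNat_le_toNat hle ENat.one_ne_top
    rw [ENat.toNat_one] at h
    exact_mod_cast h
  omega

omit [IsNoetherianRing S] [IsDomain S] [IsIntegrallyClosed S] in
/-- **`(Z·E_η) < 0` forces `E_η ⊆ Z`**: if `η ∉ t` then the effective divisor `Z = V(∏_{ζ∈t} 𝓘_ζ)` avoids the
generic point `η` (two distinct integral exceptional curves do not specialise to one another), so `(Z·E_η) ≥ 0` by
Lipman (13.1) c) (tree theorem `excCurveDegree_nonneg_of_isEffective`). [cite: Lipman1969, Proposition (13.1) c) (p. 223)] -/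
theorem mem_of_excCurveDegree_prod_neg (hπ : IsResolution π) {η : X} (hη : η ∈ excCurvePoints π)
    (t : Multiset X) (ht : ∀ ζ ∈ t, ζ ∈ excCurvePoints π)
    (hZ : IsEffectiveCartier (t.map primeDivisorIdeal).prod)
    (hneg : excCurveDegree π (CartierDivisor.ofIsEffectiveCartier (t.map primeDivisorIdeal).prod hZ) η < 0) :
    η ∈ t := by
  classical
  haveI : IsProper π := hπ.isProper
  by_contra hmem
  have hav : (CartierDivisor.ofIsEffectiveCartier (t.map primeDivisorIdeal).prod hZ).Avoids η := by
    rw [CartierDivisor.avoids_ofIsEffectiveCartier_iff]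
    intro hsupp
    have hsupp' : η ∈ (((t.map primeDivisorIdeal).prod).support : Set X) := hsupp
    rw [coe_support_prod_primeDivisorIdeal] at hsupp'
    obtain ⟨ζ, hζ, hηζ⟩ := Set.mem_iUnion₂.mp hsupp'
    have hne : η ≠ ζ := fun h => hmem (h ▸ hζ)
    exact ExcCount.not_specializes_of_mem_excCurvePoints_of_ne π hη (ht ζ hζ) hne
      (specializes_iff_mem_closure.2 hηζ)
  have hnn := excCurveDegree_nonneg_of_isEffective π hη
    (CartierDivisor.isEffective_ofIsEffectiveCartier _ hZ) hav
  exact absurd hneg (not_lt.mpr hnn)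

/-- **MAIN — a first-kind curve `E_η` with `(Z·E_η) < 0` inside an effective exceptional divisor `Z = V(∏_{ζ∈t} 𝓘_ζ)`
with `h⁰(𝒪_Z) ≤ 1` is all of `Z`: `t = {η}`.**  (`η ∈ t` by `mem_of_excCurveDegree_prod_neg`; then `Z = E_η + F` and
`F = 0` by `eq_zero_of_firstKind_of_h0_le_one_of_excCurveDegree_neg`.)  The intended `Z` is the cycle of the base
ideal `𝔪𝒪_X` of a desingularization of a rational surface singularity (`h⁰(𝒪_X/𝔪𝒪_X) ≤ 1`), for which `(Z·E) < 0`
says that `E` is not contracted by `X → Bl_𝔪 Spec S`. [cite: Lipman1969, Proposition (13.1) b), c), d) (p. 223)] -/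
theorem eq_singleton_of_firstKind_of_h0_le_one_of_excCurveDegree_neg (h2 : ringKrullDim S = 2)
    (hS : HasRationalSingularity S) (hπ : IsResolution π) {η : X} (hη : η ∈ excCurvePoints π)
    (hfk : h0 π (primeDivisorIdeal η ^ 2) = 3 * h0 π (primeDivisorIdeal η))
    (t : Multiset X) (ht : ∀ ζ ∈ t, ζ ∈ excCurvePoints π)
    (hZ : IsEffectiveCartier (t.map primeDivisorIdeal).prod)
    (hle : h0 π (t.map primeDivisorIdeal).prod ≤ 1)
    (hneg : excCurveDegree π (CartierDivisor.ofIsEffectiveCartier (t.map primeDivisorIdeal).prod hZ) η < 0) :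
    t = {η} := by
  classical
  have hmem : η ∈ t := mem_of_excCurveDegree_prod_neg hπ hη t ht hZ hneg
  obtain ⟨u, rfl⟩ : ∃ u, t = η ::ₘ u := ⟨t.erase η, (Multiset.cons_erase hmem).symm⟩
  have hu : ∀ ζ ∈ u, ζ ∈ excCurvePoints π := fun ζ hζ => ht ζ (Multiset.mem_cons_of_mem hζ)
  rw [eq_zero_of_firstKind_of_h0_le_one_of_excCurveDegree_neg h2 hS hπ hη hfk u hu hZ hle hneg,
    Multiset.cons_zero]

end Summit.ResolutionOfSingularities.ResolutionOfSingularities.Theorems.NoZeno.FirstKind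

end
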